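/-
Copyright (c) 2026. All rights reserved.
Released under Apache 2.0 license as described in the file LICENSE.
-/
import Literature.Geometry.Kaehler.ComplexTorusQuaternionMaximalOrderEuclidean
import Literature.Geometry.Kaehler.ComplexTorusQuaternionMaximalOrderTwoSidedIdeals
import Literature.NumberTheory.Automorphic.BrandtModuleDictionary
import Literature.NumberTheory.Automorphic.QuaternionOrderIntegral
import Literature.NumberTheory.Automorphic.QuaternionAlgebraAdelicReducedNormMulProofs
import Literature.NumberTheory.Automorphic.QuaternionAlgebraSplitting
import HarnessLib

/-!
# The maximal order `O₆` of `(−1,3)_ℚ` as a `ℤ`-lattice: a maximal `ℤ`-order (an Eichler order of level `1`) of a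
# division quaternion algebra, in the language of the tree's Brandt–Eichler lattice theory

The X₆ special-cycle series (`…XSixSpecialCycles*`: Kudla–Rapoport–Yang's `deg Z(t)_ℚ = 2·Σ_{[y] ∈ L(t)/O₆^×} e_y⁻¹` on
the Shimura curve of discriminant `6`) reduced KRY's closed formula (3.4.4)–(3.4.6) for ALL `t` to one missing theorem:
EICHLER'S OPTIMAL-EMBEDDING COUNT `P(m) = |L_prim(m)/O₆^×| = h(S_m)·∏_{p ∣ 6}(1 − (S_m∕p))` (Vignéras III §5 Cor. 5.12),
verified so far only value by value (`…XSixSpecialCyclesEichlerClassNumbers`). The tree's `NumberTheory/Automorphic`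
library proves Eichler's trace formula for optimal embeddings in the LATTICE language — `Submodule ℤ D` in an abstract
quaternion algebra `D` (`IsQuaternionAlgebra ℚ D`), orders `IsZOrder` ∕ `Brandt.IsOrder`, maximal orders
`IsMaximalZOrder`, Eichler orders `IsEichlerOrder`, localisations `localAt p`, right ideals `Brandt.rightIdeals`, the
classes `Brandt.ThroughClass`, `Brandt.optimalOrder`, and `Brandt.card_throughClass_optimalOrder_eq` (Vignéras III.5.11).
This file is the DICTIONARY between the two vocabularies for `B = (−1,3)_ℚ`: the maximal order
`O₆ = 𝔬 ∪ (e + 𝔬)` of the series (the predicate `x ∈ order (−1) 3 ∨ x − e ∈ order (−1) 3`, `𝔬 = ℤ⟨1, i, j, ij⟩`,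
`e = (1 + i + j − ij)/2`) is the `ℤ`-lattice

  `O₆ = ℤe ⊕ ℤi ⊕ ℤj ⊕ ℤij = Submodule.span ℤ (range ![e, i, j, ij])`

(`1 = 2e − i − j + ij`), and:

* §1 `mem_maxOrderLattice_iff` — **membership in the span IS the predicate** (half-integral coordinates of one parity,
  `maxOrder_iff_exists_halfCoords`); `order_le_maxOrderLattice` (`𝔬 ⊆ O₆`), `one_mem`, `e_mem`.
* §2 `isFullLattice_maxOrderLattice`, **`isZOrder_maxOrderLattice`** ∕ `isOrder_maxOrderLattice` (an order: `1 ∈ O₆`,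
  `O₆O₆ ⊆ O₆`, finitely generated, `ℚO₆ = B`), the reduced norm ∕ trace of the abstract theory in coordinates
  (`reducedNorm_eq_re_mul_star`: `nrd x = re(x x̄) = x₀² + x₁² − 3x₂² − 3x₃²`, `reducedTrace_eq_two_mul_re`),
  **`isMaximalZOrder_maxOrderLattice`** (every `ℤ`-order `O' ⊇ O₆` has integral reduced norms —
  `Brandt.IsOrder.exists_int_reducedTrace_reducedNorm` — hence equals `O₆` by the series' `maxOrder_isMaximal`),
  `isMaximalOrder_maxOrderLattice`, **`isEichlerOrder_one_maxOrderLattice`** (`O₆ = O₆ ∩ O₆`, level `1`).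
* §3 the algebra: `isQuaternionAlgebra_neg_one_three` (`IsQuaternionAlgebra ℚ (−1,3)_ℚ`, the tree's
  `QuaternionAlgebra.isQuaternionAlgebra_holds`), `forall_isUnit_neg_one_three` (a DIVISION algebra — the hypothesis `hD`
  of `Brandt.card_throughClass_optimalOrder_eq_of_isUnit`), `not_mem_bot_of_re_eq_zero` (a non-zero pure quaternion is
  not central: `γ ∉ ⊥`, the hypothesis `hγ`).
* §4 units: `units_mem_and_inv_mem_iff` (for `u ∈ Bˣ`: `u, u⁻¹ ∈ O₆ ⟺ u ∈ O₆ ∧ nr u = ±1`, the series' unit notion),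
  `units_smul_maxOrderLattice_eq_iff` (`uO₆ = O₆ ⟺ u ∈ O₆ ∧ nr u = ±1`).

## Sources

* M.-F. Vignéras, *Arithmétique des algèbres de quaternions*, LNM 800 (1980), Ch. I §4 Déf. (ordre, ordre maximal,
  ordre d'Eichler: «un idéal qui est un anneau», «un ordre qui n'est pas contenu dans un autre ordre»), Lemme 4.12
  (units of an order = elements of unit reduced norm), Ch. III §5 Cor. 5.3 and Exercice 5.1 (`ℤ[1,i,j,(1+i+j+ij)/2]`).
  [cite: VignerasLNM800, Ch. I §4 Déf. and Lemme 4.12; Ch. III §5 Cor. 5.3, Exercice 5.1]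
* P. Bayer, A. Travesa, *Uniformizing functions for certain Shimura curves, in the case D = 6*, Acta Arith. 126 (2007),
  §1 p. 316 («a maximal order `O₆ := ℤ[1, I, J, (1 + I + J + K)/2]` of discriminant 6»). [cite: BayerTravesa2007, §1 p. 316]
* J. Voight, *Quaternion Algebras*, GTM 288 (2021), Def. 10.2.1, 10.4.1, 23.4.1 (orders, maximal, Eichler). [cite: Voight2021, Def. 10.2.1, 10.4.1, 23.4.1]

## Scope (honest)

Theorems only — no definition, no named fact, no instance (`IsQuaternionAlgebra ℚ (−1,3)_ℚ` is a theorem to be fed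
by `haveI`); `O₆` is the inline expression `Submodule.span ℤ (Set.range ![e, i, j, ij])`. Nothing here is new
arithmetic: it transports the series' coordinate theorems (`maxOrder_iff_exists_halfCoords`, `maxOrder_mul`,
`maxOrder_isMaximal`, `exists_nat_smul_mem_order`, `isUnit_of_ne_zero`, `exists_maxOrder_inverse`) into the lattice
vocabulary consumed by the Eichler count of the sequel files.
-/

set_option maxSynthPendingDepth 3

open Quaternion Function
open scoped Pointwise
open Literature.NumberTheory.Automorphic Literature.NumberTheory.Automorphic.Brandt

namespace Literature.Geometry.Kaehler.ComplexTorus.QuaternionType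

/-! ## §1 Membership: the span `ℤ⟨e, i, j, ij⟩` is `𝔬 ∪ (e + 𝔬)` -/

section Membership

/-- The generic element of the span: `Σ cₖ vₖ = c₀e + c₁i + c₂j + c₃ij` in coordinates. [folklore] -/
private theorem sum_smul_gens₆₀ (c : Fin 4 → ℤ) :
    ∑ k, c k • (![(⟨1/2, 1/2, 1/2, -1/2⟩ : ℍ[ℚ,((-1 : ℤ) : ℚ),((3 : ℤ) : ℚ)]), ⟨0, 1, 0, 0⟩, ⟨0, 0, 1, 0⟩, ⟨0, 0, 0, 1⟩]) k =
      (⟨(c 0 : ℚ) / 2, (c 0 : ℚ) / 2 + c 1, (c 0 : ℚ) / 2 + c 2, -((c 0 : ℚ) / 2) + c 3⟩ : ℍ[ℚ,((-1 : ℤ) : ℚ),((3 : ℤ) : ℚ)]) := by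
  simp only [Fin.sum_univ_four, Matrix.cons_val_zero, Matrix.cons_val_one, Matrix.cons_val,
    ← Int.cast_smul_eq_zsmul ℚ, QuaternionAlgebra.smul_mk, smul_eq_mul, QuaternionAlgebra.mk_add_mk]
  rw [QuaternionAlgebra.mk.injEq]
  refine ⟨by ring, by ring, by ring, by ring⟩

/-- **`x ∈ ℤ⟨e, i, j, ij⟩ ⟺ x ∈ O₆ = 𝔬 ∪ (e + 𝔬)`**: the `ℤ`-span of `e = (1+i+j−ij)/2, i, j, ij` is exactly the set of
quaternions with half-integral coordinates of one parity (`1 = 2e − i − j + ij`). [cite: BayerTravesa2007, §1 p. 316] [cite: VignerasLNM800, Ch. III §5 Exercice 5.1] -/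
theorem mem_maxOrderLattice_iff (x : ℍ[ℚ,((-1 : ℤ) : ℚ),((3 : ℤ) : ℚ)]) :
    x ∈ (Submodule.span ℤ (Set.range ![(⟨1/2, 1/2, 1/2, -1/2⟩ : ℍ[ℚ,((-1 : ℤ) : ℚ),((3 : ℤ) : ℚ)]), ⟨0, 1, 0, 0⟩, ⟨0, 0, 1, 0⟩, ⟨0, 0, 0, 1⟩])) ↔ (x ∈ order (-1) 3 ∨ x - ⟨1/2, 1/2, 1/2, -1/2⟩ ∈ order (-1) 3) := by
  rw [Submodule.mem_span_range_iff_exists_fun, maxOrder_iff_exists_halfCoords]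
  constructor
  · rintro ⟨c, rfl⟩
    refine ⟨![c 0, c 0 + 2 * c 1, c 0 + 2 * c 2, -c 0 + 2 * c 3], ?_,
      ⟨-c 1, show c 0 - (c 0 + 2 * c 1) = 2 * (-c 1) by ring⟩,
      ⟨-c 2, show c 0 - (c 0 + 2 * c 2) = 2 * (-c 2) by ring⟩,
      ⟨c 0 - c 3, show c 0 - (-c 0 + 2 * c 3) = 2 * (c 0 - c 3) by ring⟩⟩
    rw [sum_smul_gens₆₀]
    simp only [Matrix.cons_val_zero, Matrix.cons_val_one, Matrix.cons_val]
    push_cast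
    rw [QuaternionAlgebra.mk.injEq]
    refine ⟨by ring, by ring, by ring, by ring⟩
  · rintro ⟨n, rfl, ⟨q1, h1⟩, ⟨q2, h2⟩, ⟨q3, h3⟩⟩
    refine ⟨![n 0, -q1, -q2, n 0 - q3], ?_⟩
    rw [sum_smul_gens₆₀]
    simp only [Matrix.cons_val_zero, Matrix.cons_val_one, Matrix.cons_val]
    have e1 : ((n 0 : ℤ) : ℚ) - n 1 = 2 * q1 := by exact_mod_cast h1
    have e2 : ((n 0 : ℤ) : ℚ) - n 2 = 2 * q2 := by exact_mod_cast h2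
    have e3 : ((n 0 : ℤ) : ℚ) - n 3 = 2 * q3 := by exact_mod_cast h3
    push_cast
    rw [QuaternionAlgebra.mk.injEq]
    refine ⟨by ring, by linear_combination (1 / 2 : ℚ) * e1, by linear_combination (1 / 2 : ℚ) * e2,
      by linear_combination (1 / 2 : ℚ) * e3⟩

/-- **`𝔬 ⊆ O₆`** (Lang's order lies in the lattice). [cite: VignerasLNM800, Ch. I §4 Exemple (2)] -/
theorem mem_maxOrderLattice_of_mem_order {x : ℍ[ℚ,((-1 : ℤ) : ℚ),((3 : ℤ) : ℚ)]} (hx : x ∈ order (-1) 3) :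
    x ∈ (Submodule.span ℤ (Set.range ![(⟨1/2, 1/2, 1/2, -1/2⟩ : ℍ[ℚ,((-1 : ℤ) : ℚ),((3 : ℤ) : ℚ)]), ⟨0, 1, 0, 0⟩, ⟨0, 0, 1, 0⟩, ⟨0, 0, 0, 1⟩])) :=
  (mem_maxOrderLattice_iff x).2 (Or.inl hx)

/-- `1 ∈ O₆` (an order contains `1`). [cite: VignerasLNM800, Ch. I §4 Déf. (ordre)] -/
theorem one_mem_maxOrderLattice : (1 : ℍ[ℚ,((-1 : ℤ) : ℚ),((3 : ℤ) : ℚ)]) ∈ (Submodule.span ℤ (Set.range ![(⟨1/2, 1/2, 1/2, -1/2⟩ : ℍ[ℚ,((-1 : ℤ) : ℚ),((3 : ℤ) : ℚ)]), ⟨0, 1, 0, 0⟩, ⟨0, 0, 1, 0⟩, ⟨0, 0, 0, 1⟩])) :=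
  mem_maxOrderLattice_of_mem_order (Subring.one_mem _)

/-- `e = (1 + i + j − ij)/2 ∈ O₆`. [cite: BayerTravesa2007, §1 p. 316] -/
theorem e_mem_maxOrderLattice : (⟨1/2, 1/2, 1/2, -1/2⟩ : ℍ[ℚ,((-1 : ℤ) : ℚ),((3 : ℤ) : ℚ)]) ∈ (Submodule.span ℤ (Set.range ![(⟨1/2, 1/2, 1/2, -1/2⟩ : ℍ[ℚ,((-1 : ℤ) : ℚ),((3 : ℤ) : ℚ)]), ⟨0, 1, 0, 0⟩, ⟨0, 0, 1, 0⟩, ⟨0, 0, 0, 1⟩])) :=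
  (mem_maxOrderLattice_iff _).2 (Or.inr (by rw [sub_self]; exact Subring.zero_mem _))

/-- `O₆` is closed under multiplication (the series' `maxOrder_mul`, transported). [cite: VignerasLNM800, Ch. I §4 Déf. (ordre)] -/
theorem mul_mem_maxOrderLattice {x y : ℍ[ℚ,((-1 : ℤ) : ℚ),((3 : ℤ) : ℚ)]} (hx : x ∈ (Submodule.span ℤ (Set.range ![(⟨1/2, 1/2, 1/2, -1/2⟩ : ℍ[ℚ,((-1 : ℤ) : ℚ),((3 : ℤ) : ℚ)]), ⟨0, 1, 0, 0⟩, ⟨0, 0, 1, 0⟩, ⟨0, 0, 0, 1⟩]))) (hy : y ∈ (Submodule.span ℤ (Set.range ![(⟨1/2, 1/2, 1/2, -1/2⟩ : ℍ[ℚ,((-1 : ℤ) : ℚ),((3 : ℤ) : ℚ)]), ⟨0, 1, 0, 0⟩, ⟨0, 0, 1, 0⟩, ⟨0, 0, 0, 1⟩]))) :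
    x * y ∈ (Submodule.span ℤ (Set.range ![(⟨1/2, 1/2, 1/2, -1/2⟩ : ℍ[ℚ,((-1 : ℤ) : ℚ),((3 : ℤ) : ℚ)]), ⟨0, 1, 0, 0⟩, ⟨0, 0, 1, 0⟩, ⟨0, 0, 0, 1⟩])) := by
  rw [mem_maxOrderLattice_iff] at hx hy ⊢
  exact maxOrder_mul hx hy

/-- Elements of `O₆` have integral reduced norm `nr x = re(x x̄) ∈ ℤ`. [cite: VignerasLNM800, Ch. I §4 Déf. (2) (entiers)] -/
theorem exists_norm_of_mem_maxOrderLattice {x : ℍ[ℚ,((-1 : ℤ) : ℚ),((3 : ℤ) : ℚ)]} (hx : x ∈ (Submodule.span ℤ (Set.range ![(⟨1/2, 1/2, 1/2, -1/2⟩ : ℍ[ℚ,((-1 : ℤ) : ℚ),((3 : ℤ) : ℚ)]), ⟨0, 1, 0, 0⟩, ⟨0, 0, 1, 0⟩, ⟨0, 0, 0, 1⟩]))) : ∃ N : ℤ, (x * star x).re = N :=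
  exists_norm_of_maxOrder ((mem_maxOrderLattice_iff x).1 hx)

end Membership

/-! ## §2 `O₆` is a maximal `ℤ`-order (an Eichler order of level `1`) -/

section Order

/-- **`O₆` is a full `ℤ`-lattice of `B`**: finitely generated, and every `x ∈ B` has `N·x ∈ O₆` for some `N ≥ 1`.
[cite: VignerasLNM800, Ch. I §4 Déf. (réseau complet, idéal)] -/
theorem isFullLattice_maxOrderLattice : IsFullLattice ℍ[ℚ,((-1 : ℤ) : ℚ),((3 : ℤ) : ℚ)] (Submodule.span ℤ (Set.range ![(⟨1/2, 1/2, 1/2, -1/2⟩ : ℍ[ℚ,((-1 : ℤ) : ℚ),((3 : ℤ) : ℚ)]), ⟨0, 1, 0, 0⟩, ⟨0, 0, 1, 0⟩, ⟨0, 0, 0, 1⟩])) := by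
  refine ⟨Submodule.fg_span (Set.finite_range _), fun d => ?_⟩
  obtain ⟨N, hN, hNd⟩ := exists_nat_smul_mem_order d
  refine ⟨N, by exact_mod_cast hN.ne', ?_⟩
  rw [← Int.cast_smul_eq_zsmul ℚ, Int.cast_natCast]
  exact mem_maxOrderLattice_of_mem_order hNd

/-- **`O₆` is a `ℤ`-order** («un idéal qui est un anneau»). [cite: VignerasLNM800, Ch. I §4 Déf. (ordre)] [cite: Voight2021, Def. 10.2.1] -/
theorem isZOrder_maxOrderLattice : IsZOrder (Submodule.span ℤ (Set.range ![(⟨1/2, 1/2, 1/2, -1/2⟩ : ℍ[ℚ,((-1 : ℤ) : ℚ),((3 : ℤ) : ℚ)]), ⟨0, 1, 0, 0⟩, ⟨0, 0, 1, 0⟩, ⟨0, 0, 0, 1⟩])) :=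
  ⟨one_mem_maxOrderLattice, fun _ hx _ hy => mul_mem_maxOrderLattice hx hy, isFullLattice_maxOrderLattice⟩

/-- `O₆` is an order in the `Brandt.IsOrder` sense (dictionary `isZOrder_iff_isOrder`). [cite: Voight2021, Def. 10.2.1] -/
theorem isOrder_maxOrderLattice : Brandt.IsOrder ℍ[ℚ,((-1 : ℤ) : ℚ),((3 : ℤ) : ℚ)] (Submodule.span ℤ (Set.range ![(⟨1/2, 1/2, 1/2, -1/2⟩ : ℍ[ℚ,((-1 : ℤ) : ℚ),((3 : ℤ) : ℚ)]), ⟨0, 1, 0, 0⟩, ⟨0, 0, 1, 0⟩, ⟨0, 0, 0, 1⟩])) :=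
  isZOrder_iff_isOrder.1 isZOrder_maxOrderLattice

/-- **The abstract reduced norm is the series' `nr x = re(x x̄)`** (`= x₀² + x₁² − 3x₂² − 3x₃²`). [cite: VignerasLNM800, Ch. I §1 (norme réduite)] -/
theorem reducedNorm_eq_re_mul_star (x : ℍ[ℚ,((-1 : ℤ) : ℚ),((3 : ℤ) : ℚ)]) : reducedNorm ℚ ℍ[ℚ,((-1 : ℤ) : ℚ),((3 : ℤ) : ℚ)] x = (x * star x).re := by
  rw [reducedNorm_quaternionAlgebra, re_mul_star_eq_coords]
  push_cast
  ring

/-- **The abstract reduced trace is `2·re x`.** [cite: VignerasLNM800, Ch. I §1 (trace réduite)] -/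
theorem reducedTrace_eq_two_mul_re (x : ℍ[ℚ,((-1 : ℤ) : ℚ),((3 : ℤ) : ℚ)]) : reducedTrace ℚ ℍ[ℚ,((-1 : ℤ) : ℚ),((3 : ℤ) : ℚ)] x = 2 * x.re := by
  rw [reducedTrace_quaternionAlgebra]

/-- **`(−1,3)_ℚ` is a quaternion algebra over `ℚ`** in the sense of `IsQuaternionAlgebra` (central, simple, dimension `4`;
a theorem, fed to the abstract theory by `haveI`). [cite: VignerasLNM800, Ch. I §1 p. 2] -/
theorem isQuaternionAlgebra_neg_one_three : IsQuaternionAlgebra ℚ ℍ[ℚ,((-1 : ℤ) : ℚ),((3 : ℤ) : ℚ)] :=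
  QuaternionAlgebra.isQuaternionAlgebra_holds (K := ℚ) (by norm_num) (by norm_num)

/-- **`O₆` IS A MAXIMAL `ℤ`-ORDER**: a `ℤ`-order `O' ⊇ O₆` consists of integral elements (integral reduced norms,
`Brandt.IsOrder.exists_int_reducedTrace_reducedNorm`), so it is `O₆` by the series' `maxOrder_isMaximal`.
[cite: VignerasLNM800, Ch. I §4 Déf. (ordre maximal); Ch. III §5 Cor. 5.3 and Exercice 5.1] [cite: BayerTravesa2007, §1 p. 316] -/
theorem isMaximalZOrder_maxOrderLattice : IsMaximalZOrder (Submodule.span ℤ (Set.range ![(⟨1/2, 1/2, 1/2, -1/2⟩ : ℍ[ℚ,((-1 : ℤ) : ℚ),((3 : ℤ) : ℚ)]), ⟨0, 1, 0, 0⟩, ⟨0, 0, 1, 0⟩, ⟨0, 0, 0, 1⟩])) := by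
  haveI := isQuaternionAlgebra_neg_one_three
  refine ⟨isZOrder_maxOrderLattice, fun O' hO' hle => ?_⟩
  have hO'B : Brandt.IsOrder ℍ[ℚ,((-1 : ℤ) : ℚ),((3 : ℤ) : ℚ)] O' := isZOrder_iff_isOrder.1 hO'
  -- `O'` as a subring with integral norms containing `O₆`
  let S : Subring ℍ[ℚ,((-1 : ℤ) : ℚ),((3 : ℤ) : ℚ)] :=
    { carrier := O'
      mul_mem' := fun ha hb => hO'.mul_mem _ ha _ hb
      one_mem' := hO'.one_mem
      add_mem' := fun ha hb => O'.add_mem ha hb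
      zero_mem' := O'.zero_mem
      neg_mem' := fun ha => O'.neg_mem ha }
  have hS : ∀ x ∈ S, ∃ N : ℤ, (x * star x).re = N := by
    intro x hx
    obtain ⟨t, n, -, hn⟩ := hO'B.exists_int_reducedTrace_reducedNorm hx
    exact ⟨n, by rw [← reducedNorm_eq_re_mul_star, hn]⟩
  have hle' : ∀ x, (x ∈ order (-1) 3 ∨ x - ⟨1/2, 1/2, 1/2, -1/2⟩ ∈ order (-1) 3) → x ∈ S :=
    fun x hx => hle ((mem_maxOrderLattice_iff x).2 hx)
  ext x
  rw [mem_maxOrderLattice_iff]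
  exact maxOrder_isMaximal (S := S) hle' hS x

/-- `O₆` is a maximal order in the `Brandt.IsMaximalOrder` sense. [cite: Voight2021, Def. 10.4.1] -/
theorem isMaximalOrder_maxOrderLattice : Brandt.IsMaximalOrder ℍ[ℚ,((-1 : ℤ) : ℚ),((3 : ℤ) : ℚ)] (Submodule.span ℤ (Set.range ![(⟨1/2, 1/2, 1/2, -1/2⟩ : ℍ[ℚ,((-1 : ℤ) : ℚ),((3 : ℤ) : ℚ)]), ⟨0, 1, 0, 0⟩, ⟨0, 0, 1, 0⟩, ⟨0, 0, 0, 1⟩])) :=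
  isMaximalZOrder_iff_isMaximalOrder.1 isMaximalZOrder_maxOrderLattice

/-- **`O₆` is an Eichler order of level `1`** (`O₆ = O₆ ∩ O₆`, index `1`). [cite: VignerasLNM800, Ch. I §4 Déf. (ordre d'Eichler)] [cite: Voight2021, Def. 23.4.1] -/
theorem isEichlerOrder_one_maxOrderLattice : IsEichlerOrder (Submodule.span ℤ (Set.range ![(⟨1/2, 1/2, 1/2, -1/2⟩ : ℍ[ℚ,((-1 : ℤ) : ℚ),((3 : ℤ) : ℚ)]), ⟨0, 1, 0, 0⟩, ⟨0, 0, 1, 0⟩, ⟨0, 0, 0, 1⟩])) 1 :=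
  isMaximalZOrder_maxOrderLattice.isEichlerOrder_one

end Order

/-! ## §3 The algebra `(−1,3)_ℚ`: division, centre -/

section Algebra

/-- **`(−1,3)_ℚ` is a division algebra**: every non-zero element is a unit (the norm form `x₀² + x₁² − 3x₂² − 3x₃²` is
anisotropic over `ℚ`) — the hypothesis `hD` of `Brandt.card_throughClass_optimalOrder_eq_of_isUnit`. [cite: VignerasLNM800, Ch. I §1; Ch. III §3 (a ramified algebra is a field)] -/
theorem forall_isUnit_neg_one_three : ∀ x : ℍ[ℚ,((-1 : ℤ) : ℚ),((3 : ℤ) : ℚ)], x ≠ 0 → IsUnit x :=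
  fun _ hx => isUnit_of_ne_zero hx

/-- The centre: `x ∈ ⊥ = ℚ·1 ⟺ x = (x₀, 0, 0, 0)` («le centre de `H` est `K`»). [cite: VignerasLNM800, Ch. I §1 p. 1–2 (algèbre centrale)] -/
theorem mem_bot_iff (x : ℍ[ℚ,((-1 : ℤ) : ℚ),((3 : ℤ) : ℚ)]) :
    x ∈ (⊥ : Subalgebra ℚ ℍ[ℚ,((-1 : ℤ) : ℚ),((3 : ℤ) : ℚ)]) ↔ x.imI = 0 ∧ x.imJ = 0 ∧ x.imK = 0 := by
  rw [Algebra.mem_bot]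
  constructor
  · rintro ⟨c, rfl⟩
    rw [QuaternionAlgebra.algebraMap_eq]
    exact ⟨rfl, rfl, rfl⟩
  · rintro ⟨h1, h2, h3⟩
    refine ⟨x.re, ?_⟩
    rw [QuaternionAlgebra.algebraMap_eq]
    ext <;> simp [h1, h2, h3]

/-- **A non-zero pure quaternion is not central** (`γ ∉ ℚ`, the hypothesis `hγ` of the abstract theory).
[cite: VignerasLNM800, Ch. I §1 (quaternions purs)] -/
theorem not_mem_bot_of_re_eq_zero {x : ℍ[ℚ,((-1 : ℤ) : ℚ),((3 : ℤ) : ℚ)]} (hre : x.re = 0) (hx : x ≠ 0) :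
    x ∉ (⊥ : Subalgebra ℚ ℍ[ℚ,((-1 : ℤ) : ℚ),((3 : ℤ) : ℚ)]) := by
  intro h
  obtain ⟨h1, h2, h3⟩ := (mem_bot_iff x).1 h
  apply hx
  ext <;> simp [hre, h1, h2, h3]

/-- In particular `ŷ = y₁i + y₂j + y₃ij ∉ ℚ` for an integer triple `y ≠ 0` (a non-zero pure quaternion is not
central). [cite: VignerasLNM800, Ch. I §1 (quaternions purs)] -/
theorem pureVec_not_mem_bot {y : ℤ × ℤ × ℤ} (hy : y ≠ 0) :
    (⟨0, y.1, y.2.1, y.2.2⟩ : ℍ[ℚ,((-1 : ℤ) : ℚ),((3 : ℤ) : ℚ)]) ∉ (⊥ : Subalgebra ℚ ℍ[ℚ,((-1 : ℤ) : ℚ),((3 : ℤ) : ℚ)]) := by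
  refine not_mem_bot_of_re_eq_zero rfl fun h => hy ?_
  have h1 : (y.1 : ℚ) = 0 := by simpa using congrArg QuaternionAlgebra.imI h
  have h2 : (y.2.1 : ℚ) = 0 := by simpa using congrArg QuaternionAlgebra.imJ h
  have h3 : (y.2.2 : ℚ) = 0 := by simpa using congrArg QuaternionAlgebra.imK h
  exact Prod.ext (by exact_mod_cast h1) (Prod.ext (by exact_mod_cast h2) (by exact_mod_cast h3))

/-- A pure quaternion of non-zero norm is not central — the hypothesis `γ ∉ ⊥` of the abstract theory for KRY's special
vectors `ŷ`, `Q(y) = t ≠ 0`. [cite: VignerasLNM800, Ch. I §1 (quaternions purs)] [cite: KudlaRapoportYang2006, §3.4 (3.4.8)] -/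
theorem pureVec_not_mem_bot_of_norm_ne_zero {y : ℤ × ℤ × ℤ} {t : ℤ} (hQ : (y.1 ^ 2 - 3 * y.2.1 ^ 2 - 3 * y.2.2 ^ 2) = t) (ht : t ≠ 0) :
    (⟨0, y.1, y.2.1, y.2.2⟩ : ℍ[ℚ,((-1 : ℤ) : ℚ),((3 : ℤ) : ℚ)]) ∉ (⊥ : Subalgebra ℚ ℍ[ℚ,((-1 : ℤ) : ℚ),((3 : ℤ) : ℚ)]) := by
  refine pureVec_not_mem_bot fun h => ht ?_
  rw [← hQ, h]
  simp

end Algebra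

/-! ## §4 Units of `O₆` -/

section Units

/-- `nr(xy) = nr x · nr y` on `(−1,3)_ℚ`, in the `re(x x̄)` form. [folklore] -/
private theorem norm_mul₆₀ (x y : ℍ[ℚ,((-1 : ℤ) : ℚ),((3 : ℤ) : ℚ)]) : ((x * y) * star (x * y)).re = (x * star x).re * (y * star y).re := by
  rw [← reducedNorm_eq_re_mul_star, ← reducedNorm_eq_re_mul_star, ← reducedNorm_eq_re_mul_star]
  haveI := isQuaternionAlgebra_neg_one_three
  exact reducedNorm_mul_holds ℚ ℍ[ℚ,((-1 : ℤ) : ℚ),((3 : ℤ) : ℚ)] x y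

/-- **For `u ∈ Bˣ`: `u ∈ O₆` and `u⁻¹ ∈ O₆` iff `u ∈ O₆` and `nr u = ±1`** — the units of the order are its elements of
unit reduced norm (Vignéras I Lemme 4.12), i.e. the series' unit notion. [cite: VignerasLNM800, Ch. I §4 Lemme 4.12] -/
theorem units_mem_and_inv_mem_iff (u : (ℍ[ℚ,((-1 : ℤ) : ℚ),((3 : ℤ) : ℚ)])ˣ) :
    ((u : ℍ[ℚ,((-1 : ℤ) : ℚ),((3 : ℤ) : ℚ)]) ∈ (Submodule.span ℤ (Set.range ![(⟨1/2, 1/2, 1/2, -1/2⟩ : ℍ[ℚ,((-1 : ℤ) : ℚ),((3 : ℤ) : ℚ)]), ⟨0, 1, 0, 0⟩, ⟨0, 0, 1, 0⟩, ⟨0, 0, 0, 1⟩])) ∧ ((u⁻¹ : (ℍ[ℚ,((-1 : ℤ) : ℚ),((3 : ℤ) : ℚ)])ˣ) : ℍ[ℚ,((-1 : ℤ) : ℚ),((3 : ℤ) : ℚ)]) ∈ (Submodule.span ℤ (Set.range ![(⟨1/2, 1/2, 1/2, -1/2⟩ : ℍ[ℚ,((-1 : ℤ) : ℚ),((3 :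 ℤ) : ℚ)]), ⟨0, 1, 0, 0⟩, ⟨0, 0, 1, 0⟩, ⟨0, 0, 0, 1⟩]))) ↔
      (((u : ℍ[ℚ,((-1 : ℤ) : ℚ),((3 : ℤ) : ℚ)]) ∈ order (-1) 3 ∨ (u : ℍ[ℚ,((-1 : ℤ) : ℚ),((3 : ℤ) : ℚ)]) - ⟨1/2, 1/2, 1/2, -1/2⟩ ∈ order (-1) 3) ∧ (((u : ℍ[ℚ,((-1 : ℤ) : ℚ),((3 : ℤ) : ℚ)]) * star (u : ℍ[ℚ,((-1 : ℤ) : ℚ),((3 : ℤ) : ℚ)])).re = 1 ∨ ((u : ℍ[ℚ,((-1 : ℤ) : ℚ),((3 : ℤ) : ℚ)]) * star (u : ℍ[ℚ,((-1 : ℤ) : ℚ),((3 : ℤ) : ℚ)])).re = -1)) := by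
  rw [mem_maxOrderLattice_iff, mem_maxOrderLattice_iff]
  constructor
  · rintro ⟨hu, hu'⟩
    refine ⟨hu, ?_⟩
    obtain ⟨N, hN⟩ := exists_norm_of_maxOrder hu
    obtain ⟨N', hN'⟩ := exists_norm_of_maxOrder hu'
    have h1 : ((u : ℍ[ℚ,((-1 : ℤ) : ℚ),((3 : ℤ) : ℚ)]) * star (u : ℍ[ℚ,((-1 : ℤ) : ℚ),((3 : ℤ) : ℚ)])).re * (((u⁻¹ : (ℍ[ℚ,((-1 : ℤ) : ℚ),((3 : ℤ) : ℚ)])ˣ) : ℍ[ℚ,((-1 : ℤ) : ℚ),((3 : ℤ) : ℚ)]) * star ((u⁻¹ : (ℍ[ℚ,((-1 : ℤ) : ℚ),((3 : ℤ) : ℚ)])ˣ) : ℍ[ℚ,((-1 : ℤ) : ℚ),((3 : ℤ) : ℚ)])).re = 1 := by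
      rw [← norm_mul₆₀, Units.mul_inv, star_one, mul_one, QuaternionAlgebra.re_one]
    rw [hN, hN'] at h1
    have h1' : N * N' = 1 := by exact_mod_cast h1
    rw [hN]
    rcases Int.eq_one_or_neg_one_of_mul_eq_one h1' with h | h
    · left; rw [h]; simp
    · right; rw [h]; simp
  · rintro ⟨hu, hn⟩
    refine ⟨hu, ?_⟩
    have hn' : (u : ℍ[ℚ,((-1 : ℤ) : ℚ),((3 : ℤ) : ℚ)]) * star (u : ℍ[ℚ,((-1 : ℤ) : ℚ),((3 : ℤ) : ℚ)]) = 1 ∨ (u : ℍ[ℚ,((-1 : ℤ) : ℚ),((3 : ℤ) : ℚ)]) * star (u : ℍ[ℚ,((-1 : ℤ) : ℚ),((3 : ℤ) : ℚ)]) = -1 := by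
      rcases hn with h | h
      · left; rw [QuaternionAlgebra.mul_star_eq_coe, h, QuaternionAlgebra.coe_one]
      · right; rw [QuaternionAlgebra.mul_star_eq_coe, h, QuaternionAlgebra.coe_neg, QuaternionAlgebra.coe_one]
    obtain ⟨v, hv, huv, hvu⟩ := exists_maxOrder_inverse hu hn'
    have : ((u⁻¹ : (ℍ[ℚ,((-1 : ℤ) : ℚ),((3 : ℤ) : ℚ)])ˣ) : ℍ[ℚ,((-1 : ℤ) : ℚ),((3 : ℤ) : ℚ)]) = v := by
      rw [← mul_one ((u⁻¹ : (ℍ[ℚ,((-1 : ℤ) : ℚ),((3 : ℤ) : ℚ)])ˣ) : ℍ[ℚ,((-1 : ℤ) : ℚ),((3 : ℤ) : ℚ)]), ← huv, ← mul_assoc, Units.inv_mul, one_mul]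
    rwa [this]

/-- **`uO₆ = O₆ ⟺ u ∈ O₆ ∧ nr u = ±1`** (`u ∈ Bˣ`): the stabiliser of the lattice `O₆` under left multiplication is
its unit group. [cite: VignerasLNM800, Ch. I §4 Lemme 4.12] -/
theorem units_smul_maxOrderLattice_eq_iff (u : (ℍ[ℚ,((-1 : ℤ) : ℚ),((3 : ℤ) : ℚ)])ˣ) :
    u • (Submodule.span ℤ (Set.range ![(⟨1/2, 1/2, 1/2, -1/2⟩ : ℍ[ℚ,((-1 : ℤ) : ℚ),((3 : ℤ) : ℚ)]), ⟨0, 1, 0, 0⟩, ⟨0, 0, 1, 0⟩, ⟨0, 0, 0, 1⟩])) = (Submodule.span ℤ (Set.range ![(⟨1/2, 1/2, 1/2, -1/2⟩ : ℍ[ℚ,((-1 : ℤ) : ℚ),((3 : ℤ) : ℚ)]), ⟨0, 1, 0, 0⟩, ⟨0, 0, 1, 0⟩, ⟨0, 0, 0, 1⟩])) ↔ (((u : ℍ[ℚ,((-1 : ℤ) : ℚ),((3 : ℤ) : ℚ)]) ∈ order (-1) 3 ∨ (u : ℍ[ℚ,((-1 : ℤ) : ℚ),((3 : ℤ) : ℚ)])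 - ⟨1/2, 1/2, 1/2, -1/2⟩ ∈ order (-1) 3) ∧ (((u : ℍ[ℚ,((-1 : ℤ) : ℚ),((3 : ℤ) : ℚ)]) * star (u : ℍ[ℚ,((-1 : ℤ) : ℚ),((3 : ℤ) : ℚ)])).re = 1 ∨ ((u : ℍ[ℚ,((-1 : ℤ) : ℚ),((3 : ℤ) : ℚ)]) * star (u : ℍ[ℚ,((-1 : ℤ) : ℚ),((3 : ℤ) : ℚ)])).re = -1)) := by
  rw [← units_mem_and_inv_mem_iff, ← MulAction.mem_stabilizer_iff, mem_stabilizer_iff_mem_leftOrder,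
    leftOrder_eq_self_of_one_mem one_mem_maxOrderLattice (fun _ hx _ hy => mul_mem_maxOrderLattice hx hy)]

end Units

end Literature.Geometry.Kaehler.ComplexTorus.QuaternionType
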